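import Summits.Ventures.PercRepro0.ChiBox

/-!
# PM-D · CHI-LOWER on the cell's definitions, part 2: Lemmas C–D, the theorem and its corollary
(seat p2, block-M census evidence; BK as an explicit hypothesis)

Part 2 of the Lean twin of route/TMID-CENSUS-v7-plan-2.md §3.4 (PM-D · CHI-LOWER, Lemmas A–D, as re-derived
by rev-2 in REVIEW-TMID-CENSUS-v7-plan-2-rev-2 §3 and by rev-1 on 2026-08-26T05:02:49Z), written on the lead's
RULING F (7)(d′) of 2026-08-26T05:05:07Z, on the tree's own objects (part 1 = `ChiBox.lean`: `χ^n`, monotone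
convergence, Lemmas A–B). `χ` is `PcChi.chi d p = ∑' x, P_p(0 ↔ x)` (extended real) — no new `χ`, no new `τ`.

* **Lemma C** `inv_chi_sub_le` (given BK): `1/χ_a − 1/χ_b ≤ 2d (b − a)` for `0 ≤ a ≤ b ≤ 1` with `χ_b < ∞`
  (uniform partition of `[a, b]` into `N` parts, Lemma B on each part (`inv_chi_sub_le_step`: the ratio
  `χ(t_{i+1})/χ(t_i) ≤ 1 + 2d χ_b² (t_{i+1} − t_i)` uses Lemma B's Lipschitz bound and `χ ≥ 1`), the telescoping
  sum `Finset.sum_range_sub'`, and `N → ∞`; no differentiability of `χ` is used);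
* **Lemma D** `exists_chi_ge`: `χ_q → ∞` as `q ↑ p_c(d)` — `ChiCrit.chi_pc_eq_top` gives a finite partial sum
  of `χ_{p_c}` exceeding any `M`, and the partial sum is left-continuous at `p_c(d)` (`continuousWithinAt_tau_Iio`,
  F4(ii));
* **Theorem** `inv_le_chi_toReal` / `chi_lower` (given BK; `d ≥ 1`): for every `q ∈ [0, p_c(d))`,
  `1/(2d (p_c(d) − q)) ≤ χ_d(q)` — Lemma C with `b ↑ p_c(d)` (Lemma D: `1/χ_b ≤ ε`);
* **Corollary** `lintegral_chi_eq_top` (given BK; `d ≥ 1`): `∫_p^{p_c(d)} χ_d(q) dq = ∞` for every `0 ≤ p < p_c(d)`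
  (Lebesgue integral over `(p, p_c(d)]`): `∫_p^b dq/(2d (p_c(d) − q)) = (2d)⁻¹ log ((p_c(d) − p)/(p_c(d) − b))`
  (`integral_inv_pc_sub`) equals `M` at `b = p_c(d) − (p_c(d) − p) e^{−2dM}`, for every `M`.

The hypothesis `hBK : Bubble.BK d` is P10 · BK in p4's named form (module DisjOcc); it is discharged by
`Bubble.BK_holds` (BubbleClose, from p2's `BK.P_disjointOcc_le`) in the one-theorem-per-statement module
`ChiLowerClose.lean` (`chi_lower'` / `inv_le_chi_toReal'` / `lintegral_chi_eq_top'`), so PM-D · CHI-LOWER is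
kernel-checked with NO hypothesis.

This is a LOWER bound on `χ` below `p_c(d)`: census evidence only, off every declaration path, not a door,
not a status change; NOTHING here asserts anything about `B_q`, `∫ B_q dq` or `T(d)` for any `3 ≤ d ≤ 10`.
Attribution context (census §3.4): the differential inequality `χ' ≤ 2d χ²` is classical [mem, not for
citation]; the proof here is the cell's own on the cell's definitions.
-/

namespace Summit.Ventures.PercRepro0.ChiLower

open MeasureTheory ProbabilityTheory unitInterval Set Filter Topology
open Summit.Ventures.PercRepro0.Defs
open Summit.Ventures.PercRepro0.Sharp
open Summit.Ventures.PercRepro0.Bubble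
open Summit.Ventures.PercRepro0.PcChi (chi)
open scoped ENNReal NNReal Classical

variable {d : ℕ}

/-! ### Lemma C: the inequality for `1/χ` -/

/-- One step of Lemma C: for `0 ≤ s ≤ t ≤ b ≤ 1` with `χ_b < ∞`,
`1/χ_s − 1/χ_t ≤ 2d (t − s) (1 + 2d χ_b² (t − s))` (Lemma B twice, `χ ≥ 1`). -/
theorem inv_chi_sub_le_step (hBK : BK d) {s t b : ℝ} (hs : 0 ≤ s) (hst : s ≤ t) (htb : t ≤ b)
    (hb1 : b ≤ 1) (hfin : chi d (clamp b) ≠ ⊤) :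
    1 / (chi d (clamp s)).toReal - 1 / (chi d (clamp t)).toReal ≤
      2 * d * (t - s) * (1 + 2 * d * (chi d (clamp b)).toReal ^ 2 * (t - s)) := by
  have hfint : chi d (clamp t) ≠ ⊤ := ne_top_of_le_ne_top hfin (chi_mono (clamp_mono htb))
  have hfins : chi d (clamp s) ≠ ⊤ := ne_top_of_le_ne_top hfint (chi_mono (clamp_mono hst))
  set gs := (chi d (clamp s)).toReal with hgs
  set gt := (chi d (clamp t)).toReal with hgt
  set gb := (chi d (clamp b)).toReal with hgb
  have h1s : 1 ≤ gs := one_le_chi_toReal _ hfins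
  have hst' : gs ≤ gt := ENNReal.toReal_mono hfint (chi_mono (clamp_mono hst))
  have htb' : gt ≤ gb := ENNReal.toReal_mono hfin (chi_mono (clamp_mono htb))
  have hB : gt - gs ≤ 2 * d * gt ^ 2 * (t - s) := chi_sub_le hBK hs hst (htb.trans hb1) hfint
  have hc0 : (0 : ℝ) ≤ 2 * d := by positivity
  have hD : 0 ≤ t - s := sub_nonneg.2 hst
  have hgspos : 0 < gs := by linarith
  have hgtpos : 0 < gt := by linarith
  have hK0 : 0 ≤ 2 * d * gb ^ 2 := by positivity
  have hK : gt - gs ≤ 2 * d * gb ^ 2 * (t - s) := by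
    refine hB.trans (mul_le_mul_of_nonneg_right (mul_le_mul_of_nonneg_left ?_ hc0) hD)
    exact pow_le_pow_left₀ hgtpos.le htb' 2
  have key : gt - gs ≤ 2 * d * (t - s) * (1 + 2 * d * gb ^ 2 * (t - s)) * (gs * gt) := by
    calc gt - gs ≤ 2 * d * gt ^ 2 * (t - s) := hB
      _ = 2 * d * (t - s) * gt * (gs + (gt - gs)) := by ring
      _ ≤ 2 * d * (t - s) * gt * (gs + 2 * d * gb ^ 2 * (t - s)) :=
          mul_le_mul_of_nonneg_left (add_le_add le_rfl hK) (mul_nonneg (mul_nonneg hc0 hD) hgtpos.le)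
      _ = 2 * d * (t - s) * (gs * gt) + 2 * d * (t - s) * (2 * d * gb ^ 2 * (t - s)) * gt := by ring
      _ ≤ 2 * d * (t - s) * (gs * gt) + 2 * d * (t - s) * (2 * d * gb ^ 2 * (t - s)) * (gs * gt) :=
          add_le_add le_rfl (mul_le_mul_of_nonneg_left (le_mul_of_one_le_left hgtpos.le h1s)
            (mul_nonneg (mul_nonneg hc0 hD) (mul_nonneg hK0 hD)))
      _ = 2 * d * (t - s) * (1 + 2 * d * gb ^ 2 * (t - s)) * (gs * gt) := by ring
  rw [div_sub_div _ _ hgspos.ne' hgtpos.ne', div_le_iff₀ (mul_pos hgspos hgtpos)]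
  linarith [key]

/-- **Lemma C** (given BK): for `0 ≤ a ≤ b ≤ 1` with `χ_b < ∞`, `1/χ_a − 1/χ_b ≤ 2d (b − a)`
(uniform partition of `[a, b]` into `N` parts, the telescoping sum, and `N → ∞`). -/
theorem inv_chi_sub_le (hBK : BK d) {a b : ℝ} (ha : 0 ≤ a) (hab : a ≤ b) (hb1 : b ≤ 1)
    (hfin : chi d (clamp b) ≠ ⊤) :
    1 / (chi d (clamp a)).toReal - 1 / (chi d (clamp b)).toReal ≤ 2 * d * (b - a) := by
  set K : ℝ := 2 * d * (chi d (clamp b)).toReal ^ 2 with hK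
  have hD : 0 ≤ b - a := sub_nonneg.2 hab
  have hstep : ∀ N : ℕ, 0 < N →
      1 / (chi d (clamp a)).toReal - 1 / (chi d (clamp b)).toReal ≤
        2 * d * (b - a) + 2 * d * K * (b - a) ^ 2 / N := by
    intro N hNpos
    have hNr : (0 : ℝ) < N := by exact_mod_cast hNpos
    set h : ℝ := (b - a) / N with hh
    have hh0 : 0 ≤ h := div_nonneg hD hNr.le
    have hNh : (N : ℝ) * h = b - a := by
      rw [hh]
      field_simp
    set t : ℕ → ℝ := fun i => a + i * h with ht
    have ht0 : t 0 = a := by simp [ht]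
    have htN : t N = b := by
      simp only [ht]
      linarith
    have hti : ∀ i : ℕ, i ≤ N → 0 ≤ t i ∧ t i ≤ b := by
      intro i hi
      have hi' : (i : ℝ) ≤ N := by exact_mod_cast hi
      have hih : (i : ℝ) * h ≤ N * h := mul_le_mul_of_nonneg_right hi' hh0
      simp only [ht]
      constructor
      · positivity
      · linarith
    have hsucc : ∀ i : ℕ, t (i + 1) - t i = h := by
      intro i
      simp only [ht]
      push_cast
      ring
    have hterm : ∀ i ∈ Finset.range N,
        1 / (chi d (clamp (t i))).toReal - 1 / (chi d (clamp (t (i + 1)))).toReal ≤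
          2 * d * h * (1 + K * h) := by
      intro i hi
      have hi' : i + 1 ≤ N := Finset.mem_range.1 hi
      obtain ⟨h0i, _⟩ := hti i (by omega)
      obtain ⟨_, hi1b⟩ := hti (i + 1) hi'
      have hle : t i ≤ t (i + 1) := by linarith [hsucc i]
      have := inv_chi_sub_le_step hBK h0i hle hi1b hb1 hfin
      rwa [hsucc i] at this
    have hsum := Finset.sum_le_sum hterm
    rw [Finset.sum_range_sub' (fun i => 1 / (chi d (clamp (t i))).toReal) N, ht0, htN,
      Finset.sum_const, Finset.card_range, nsmul_eq_mul] at hsum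
    have hval : (N : ℝ) * (2 * d * h * (1 + K * h)) = 2 * d * (b - a) + 2 * d * K * (b - a) ^ 2 / N := by
      calc (N : ℝ) * (2 * d * h * (1 + K * h)) = 2 * d * (N * h) * (1 + K * h) := by ring
        _ = 2 * d * (b - a) * (1 + K * h) := by rw [hNh]
        _ = 2 * d * (b - a) + 2 * d * K * (b - a) * h := by ring
        _ = 2 * d * (b - a) + 2 * d * K * (b - a) ^ 2 / N := by rw [hh]; ring
    calc 1 / (chi d (clamp a)).toReal - 1 / (chi d (clamp b)).toReal
        ≤ N * (2 * d * h * (1 + K * h)) := hsum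
      _ = 2 * d * (b - a) + 2 * d * K * (b - a) ^ 2 / N := hval
  have hlim : Tendsto (fun N : ℕ => 2 * d * (b - a) + 2 * d * K * (b - a) ^ 2 / N) atTop
      (𝓝 (2 * d * (b - a) + 0)) :=
    tendsto_const_nhds.add (tendsto_const_div_atTop_nhds_zero_nat _)
  rw [add_zero] at hlim
  refine ge_of_tendsto hlim ?_
  filter_upwards [eventually_gt_atTop 0] with N hN
  exact hstep N hN

/-! ### Lemma D: `χ_q → ∞` as `q ↑ p_c(d)` -/

/-- **Lemma D**: for every `M` and every `a ∈ [0, p_c(d))` there is `b ∈ [a, p_c(d))` with `M ≤ χ_b`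
(`ChiCrit.chi_pc_eq_top`: some finite partial sum of `χ_{p_c}` exceeds `M`; the partial sum is
left-continuous at `p_c(d)` by `continuousWithinAt_tau_Iio`). -/
theorem exists_chi_ge (hd : 1 ≤ d) {a : ℝ} (ha : 0 ≤ a) (hapc : a < pc d) (M : ℝ) :
    ∃ b : ℝ, a ≤ b ∧ b < pc d ∧ M ≤ (chi d (clamp b)).toReal := by
  have htop : chi d (clamp (pc d)) = ⊤ := ChiCrit.chi_pc_eq_top hd
  have hlt : ENNReal.ofReal M <
      ⨆ S : Finset (Vertex d), ∑ x ∈ S, P d (clamp (pc d)) {ω : Config d | Conn d ω 0 x} := by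
    rw [← ENNReal.tsum_eq_iSup_sum, ← chi, htop]
    exact ENNReal.ofReal_lt_top
  obtain ⟨S, hS⟩ := lt_iSup_iff.1 hlt
  have hM : M < ∑ x ∈ S, tau d (clamp (pc d)) 0 x := by
    have h1 : ENNReal.ofReal M < ENNReal.ofReal (∑ x ∈ S, tau d (clamp (pc d)) 0 x) := by
      unfold tau
      rw [ENNReal.ofReal_sum_of_nonneg fun x _ => ENNReal.toReal_nonneg]
      have h2 : ∑ x ∈ S, ENNReal.ofReal (P d (clamp (pc d)) {ω : Config d | Conn d ω 0 x}).toReal =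
          ∑ x ∈ S, P d (clamp (pc d)) {ω : Config d | Conn d ω 0 x} :=
        Finset.sum_congr rfl fun x _ => ENNReal.ofReal_toReal (measure_ne_top _ _)
      rw [h2]
      exact hS
    exact (ENNReal.ofReal_lt_ofReal_iff'.1 h1).1
  have hcont : Tendsto (fun r : ℝ => ∑ x ∈ S, tau d (clamp r) 0 x) (𝓝[<] (pc d))
      (𝓝 (∑ x ∈ S, tau d (clamp (pc d)) 0 x)) :=
    tendsto_finsetSum S fun x _ => continuousWithinAt_tau_Iio 0 x (pc d)
  have hev1 : ∀ᶠ r in 𝓝[<] (pc d), M < ∑ x ∈ S, tau d (clamp r) 0 x := hcont.eventually (lt_mem_nhds hM)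
  have hev2 : ∀ᶠ r in 𝓝[<] (pc d), a < r := mem_nhdsWithin_of_mem_nhds (Ioi_mem_nhds hapc)
  have hev3 : ∀ᶠ r in 𝓝[<] (pc d), r < pc d := self_mem_nhdsWithin
  obtain ⟨r, hMr, har', hrpc'⟩ := (hev1.and (hev2.and hev3)).exists
  refine ⟨r, har'.le, hrpc', ?_⟩
  have hfin : chi d (clamp r) ≠ ⊤ := (chi_clamp_lt_top hd (ha.trans har'.le) hrpc').ne
  calc M ≤ ∑ x ∈ S, tau d (clamp r) 0 x := hMr.le
    _ = (∑ x ∈ S, P d (clamp r) {ω : Config d | Conn d ω 0 x}).toReal := by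
        rw [ENNReal.toReal_sum fun x _ => measure_ne_top _ _]
        rfl
    _ ≤ (chi d (clamp r)).toReal := ENNReal.toReal_mono hfin (ENNReal.sum_le_tsum _)

/-! ### The theorem and its corollary -/

/-- **PM-D · CHI-LOWER, real form** (given BK; `d ≥ 1`): for `0 ≤ q < p_c(d)`,
`1/(2d (p_c(d) − q)) ≤ χ_d(q)`. -/
theorem inv_le_chi_toReal (hd : 1 ≤ d) (hBK : BK d) {q : ℝ} (hq0 : 0 ≤ q) (hq : q < pc d) :
    1 / (2 * d * (pc d - q)) ≤ (chi d (clamp q)).toReal := by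
  have hfinq : chi d (clamp q) ≠ ⊤ := (chi_clamp_lt_top hd hq0 hq).ne
  have h1 : 1 ≤ (chi d (clamp q)).toReal := one_le_chi_toReal _ hfinq
  have hgpos : 0 < (chi d (clamp q)).toReal := by linarith
  have hpcq : 0 < pc d - q := sub_pos.2 hq
  have hd0 : (0 : ℝ) < 2 * d := by
    have : (1 : ℝ) ≤ d := by exact_mod_cast hd
    linarith
  have key : 1 / (chi d (clamp q)).toReal ≤ 2 * d * (pc d - q) := by
    refine le_of_forall_pos_le_add fun ε hε => ?_
    obtain ⟨b, hqb, hbpc, hMb⟩ := exists_chi_ge hd hq0 hq (1 / ε)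
    have hfinb : chi d (clamp b) ≠ ⊤ := (chi_clamp_lt_top hd (hq0.trans hqb) hbpc).ne
    have hC := inv_chi_sub_le hBK hq0 hqb (hbpc.le.trans (pc_le_one hd)) hfinb
    have hgbpos : 0 < (chi d (clamp b)).toReal := lt_of_lt_of_le (by positivity) hMb
    have hinv : 1 / (chi d (clamp b)).toReal ≤ ε := by
      rw [div_le_iff₀ hgbpos]
      calc (1 : ℝ) = ε * (1 / ε) := by field_simp
        _ ≤ ε * (chi d (clamp b)).toReal := mul_le_mul_of_nonneg_left hMb hε.le
    have hbq : 2 * d * (b - q) ≤ 2 * d * (pc d - q) := mul_le_mul_of_nonneg_left (by linarith) hd0.le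
    linarith
  rw [div_le_iff₀ (mul_pos hd0 hpcq)]
  rw [div_le_iff₀ hgpos] at key
  linarith

/-- **PM-D · CHI-LOWER** (census v7 §3.4; given BK; `d ≥ 1`): for every `q ∈ [0, p_c(d))`,
`ENNReal.ofReal (1/(2d (p_c(d) − q))) ≤ χ_d(q)`. -/
theorem chi_lower (hd : 1 ≤ d) (hBK : BK d) {q : ℝ} (hq0 : 0 ≤ q) (hq : q < pc d) :
    ENNReal.ofReal (1 / (2 * d * (pc d - q))) ≤ chi d (clamp q) :=
  calc ENNReal.ofReal (1 / (2 * d * (pc d - q))) ≤ ENNReal.ofReal (chi d (clamp q)).toReal :=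
        ENNReal.ofReal_le_ofReal (inv_le_chi_toReal hd hBK hq0 hq)
    _ = chi d (clamp q) := ENNReal.ofReal_toReal (chi_clamp_lt_top hd hq0 hq).ne

/-- `∫_p^b dq / (2d (p_c(d) − q)) = (2d)⁻¹ log ((p_c(d) − p)/(p_c(d) − b))` for `p ≤ b < p_c(d)`. -/
theorem integral_inv_pc_sub (hd : 1 ≤ d) {p b : ℝ} (hpb : p ≤ b) (hb : b < pc d) :
    ∫ q in p..b, 1 / (2 * d * (pc d - q)) = (2 * (d : ℝ))⁻¹ * Real.log ((pc d - p) / (pc d - b)) := by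
  have hd0 : (0 : ℝ) < 2 * d := by
    have : (1 : ℝ) ≤ d := by exact_mod_cast hd
    linarith
  have h1 : (fun q : ℝ => 1 / (2 * d * (pc d - q))) =
      fun q => (fun x : ℝ => (2 * (d : ℝ))⁻¹ * (1 / x)) (pc d - q) := by
    funext q
    simp only [one_div, mul_inv]
  have h0 : (0 : ℝ) ∉ Set.uIcc (pc d - b) (pc d - p) :=
    Set.notMem_uIcc_of_lt (by linarith) (by linarith)
  rw [h1, intervalIntegral.integral_comp_sub_left (fun x : ℝ => (2 * (d : ℝ))⁻¹ * (1 / x)) (pc d),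
    intervalIntegral.integral_const_mul, integral_one_div h0]

/-- **Corollary** (given BK; `d ≥ 1`): `∫_p^{p_c(d)} χ_d(q) dq = ∞` for every `0 ≤ p < p_c(d)`
(Lebesgue integral over `(p, p_c(d)]`): `χ_d(q) ≥ 1/(2d (p_c(d) − q))` is not integrable at `p_c(d)`. -/
theorem lintegral_chi_eq_top (hd : 1 ≤ d) (hBK : BK d) {p : ℝ} (hp0 : 0 ≤ p) (hp : p < pc d) :
    ∫⁻ q in Set.Ioc p (pc d), chi d (clamp q) = ⊤ := by
  have hd0 : (0 : ℝ) < 2 * d := by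
    have : (1 : ℝ) ≤ d := by exact_mod_cast hd
    linarith
  have hpp : 0 < pc d - p := sub_pos.2 hp
  refine ENNReal.eq_top_of_forall_nnreal_le fun r => ?_
  set M : ℝ := r + 1 with hM
  have hM0 : 0 < M := by positivity
  set b : ℝ := pc d - (pc d - p) * Real.exp (-(2 * d * M)) with hb
  have hexp0 : 0 < Real.exp (-(2 * d * M)) := Real.exp_pos _
  have hexp1 : Real.exp (-(2 * d * M)) < 1 := by
    rw [Real.exp_lt_one_iff]
    have := mul_pos hd0 hM0
    linarith
  have hpb : p < b := by
    have : (pc d - p) * Real.exp (-(2 * d * M)) < (pc d - p) * 1 :=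
      mul_lt_mul_of_pos_left hexp1 hpp
    simp only [hb]
    linarith
  have hbpc : b < pc d := by
    have : 0 < (pc d - p) * Real.exp (-(2 * d * M)) := mul_pos hpp hexp0
    simp only [hb]
    linarith
  have hpcb : pc d - b = (pc d - p) * Real.exp (-(2 * d * M)) := by
    simp only [hb]
    ring
  -- the value of the integral up to `b` is exactly `M`
  have hval : ∫ q in p..b, 1 / (2 * d * (pc d - q)) = M := by
    rw [integral_inv_pc_sub hd hpb.le hbpc, hpcb, div_mul_eq_div_div, div_self hpp.ne', one_div,
      Real.exp_neg, inv_inv, Real.log_exp, ← mul_assoc, inv_mul_cancel₀ hd0.ne', one_mul]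
  -- the integrand is continuous, hence integrable, on `[p, b]`
  have hcont : ContinuousOn (fun q : ℝ => 1 / (2 * d * (pc d - q))) (Set.Icc p b) := by
    refine ContinuousOn.div continuousOn_const (by fun_prop) fun q hq => ?_
    have : 0 < pc d - q := by linarith [hq.2]
    positivity
  have hint : IntegrableOn (fun q : ℝ => 1 / (2 * d * (pc d - q))) (Set.Ioc p b) :=
    (hcont.integrableOn_Icc).mono_set Set.Ioc_subset_Icc_self
  have hnn : 0 ≤ᵐ[volume.restrict (Set.Ioc p b)] fun q : ℝ => 1 / (2 * d * (pc d - q)) := by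
    refine ae_restrict_of_forall_mem measurableSet_Ioc fun q hq => ?_
    have : 0 < pc d - q := by linarith [hq.2]
    positivity
  calc (r : ℝ≥0∞) = ENNReal.ofReal r := ENNReal.ofReal_coe_nnreal.symm
    _ ≤ ENNReal.ofReal M := ENNReal.ofReal_le_ofReal (by rw [hM]; linarith)
    _ = ENNReal.ofReal (∫ q in p..b, 1 / (2 * d * (pc d - q))) := by rw [hval]
    _ = ∫⁻ q in Set.Ioc p b, ENNReal.ofReal (1 / (2 * d * (pc d - q))) := by
        rw [intervalIntegral.integral_of_le hpb.le, ofReal_integral_eq_lintegral_ofReal hint hnn]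
    _ ≤ ∫⁻ q in Set.Ioc p b, chi d (clamp q) := by
        refine setLIntegral_mono' measurableSet_Ioc fun q hq => ?_
        exact chi_lower hd hBK (hp0.trans hq.1.le) (hq.2.trans_lt hbpc)
    _ ≤ ∫⁻ q in Set.Ioc p (pc d), chi d (clamp q) :=
        lintegral_mono_set (Set.Ioc_subset_Ioc_right hbpc.le)

end Summit.Ventures.PercRepro0.ChiLower
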